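import Mathlib.Analysis.Polynomial.Norm
import Literature.NumberTheory.EllipticCurves.PlusMinusPAdicLFunction
import Literature.NumberTheory.EllipticCurves.CuspFormTwistRatPlusSymbol
import Literature.NumberTheory.EllipticCurves.NewformPadicIntegralModel
import HarnessLib

/-!
# Mazur–Tate elements of a weight-`2` newform with coefficients in its Hecke field and cohomological
# periods (Pollack–Weston)

R. Pollack, T. Weston, *Mazur–Tate elements of nonordinary modular forms*, Duke Math. J. **156**
(2011) 349–385 [PollackWeston2011MT] (held text `paper:arxiv-0906.1741`), §2.1–§2.2 and §3.1.

The tree's Mazur–Tate element `mazurTateElement f p n ∈ ℚ[T]` (`PlusMinusPAdicLFunction.lean`) is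
built from the RATIONAL plus symbol `ratPlusSymbol f r = [r]⁺_f ∈ ℚ` (`PAdicLFunction.lean`), which is
meaningful only for newforms with rational coefficients (`coeffField f = ⊥`, Manin–Drinfeld). For a
newform `g ∈ S₂(Γ₀(N))` whose Hecke field `K_g = coeffField g` is bigger than `ℚ` (e.g. a CM theta
newform `g_ψ`, the "Hecke theta partner" of a non-CM curve at `p = 2`, cell `bsd-f1-sign2`), the
plus symbol `{∞, r}⁺_g / Ω` lies in `K_g` for a suitable period `Ω` (Shimura), and the Iwasawa theory
of `g` at a prime `λ ∣ p` of `K_g` reads these values through an embedding `ι : K_g → ℚ̄_p`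
(Pollack–Weston: "our fixed embedding `ℚ̄ ↪ ℚ̄_p`"; the tree's convention for `p`-adically embedded
newforms, `OrdinaryPadicData g p ι`, `padicCoeffIntegers`). This file supplies that vocabulary —
DEFINITIONS with bodies and proved API only; NOTHING is asserted (no named fact):

* `IsPlusPeriod g Ω` (`Ω ∈ ℂ`): `Ω ≠ 0` and `plusSymbol g r / Ω ∈ K_g` for every `r ∈ ℚ` — "By a
  theorem of Shimura [Shimura 1977, Thm. 1], there exists complex numbers `Ω^±_f` such that `ξ^±_f`
  takes values in `V_{k-2}(K_f) Ω^±_f` where `K_f` is the field of Fourier coefficients of `f`"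
  (PW §2.2; weight `2`, plus part). A PREDICATE on `(g, Ω)`; Shimura's existence theorem is NOT
  asserted here.
* `plusSymbolK g Ω r : coeffField g` — PW's `φ⁺_f = ξ⁺_f/Ω⁺_f` on `{∞} - {r}` in the tree's
  orientation: the element `plusSymbol g r / Ω` of `K_g` (junk `0` if it is not in `K_g`, exactly as
  `ratPlusSymbol` has junk `0`); `IsPlusPeriod.coe_plusSymbolK`.
* `mazurTateElementK g Ω p n : (coeffField g)[X]` — VERBATIM the formula of `mazurTateElement` with
  `ratPlusSymbol f` replaced by `plusSymbolK g Ω` (`1 + T ↔ γ = cyclotomicGenerator p`, level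
  `p^{n+e₀}`, Teichmüller parametrisation `a = η γ^s`; for `p = 2` the level is `2^{n+2}`,
  `Γ = 1 + 4ℤ₂`, as there): PW (2.1) `ϑ_n(φ) = ∑_{a ∈ (ℤ/p^n)^×} φ({∞} - {a/p^n}) σ_a` projected to
  `R[G_n]` by `ω⁰` (§2.1), written as the canonical lift of degree `< p^n` in `T = γ - 1`.
  PROVED: for a RATIONAL newform `f` and `Ω = Ω⁺_f = plusPeriod f` these are the tree's objects —
  `isPlusPeriod_plusPeriod`, `plusSymbolK_plusPeriod_eq_algebraMap` (`= ratPlusSymbol f r`),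
  `mazurTateElementK_plusPeriod_eq` (`= (mazurTateElement f p n).map (algebraMap ℚ K_f)`).
* `IsCohomologicalPlusPeriod g ι Ω` — PW **Definition 2.1** ("cohomological periods … with respect
  to our fixed embedding `ℚ̄ ↪ ℚ̄_p`, if `‖φ⁺_f‖ = ‖φ⁻_f‖ = 1`; that is, if each of `φ^±_f` takes
  values in `V_{k-2}(𝒪_f)`, and each takes on at least one value with at least one coefficient in
  `𝒪_f^×`. Such periods clearly always exist for each `f` and are well-defined up to scaling by
  elements `α ∈ K_f` such that the image of `α` in `ℚ̄_p` is a `p`-adic unit"), PLUS PART, weight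
  `2`: `IsPlusPeriod g Ω`, `‖ι [r]⁺‖ ≤ 1` for all `r`, and `‖ι [r]⁺‖ = 1` for some `r`. (PW's norm
  `‖φ‖ = max_{D ∈ Δ₀} ‖φ(D)‖`; in weight `2`, `φ({r} - {s}) = φ({∞}-{s}) - φ({∞}-{r})` and
  `{∞} - {r} ∈ Δ₀`, so by the ultrametric inequality `‖φ⁺‖ = max_r ‖φ⁺({∞}-{r})‖` and the two
  clauses say `‖φ⁺_g‖ = 1`.) PROVED (PW **Remark 2.2**, "our choice of periods forces these
  Mazur–Tate elements to have integral coefficients"): `norm_coeff_map_mazurTateElementK_le_one`.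
* The layer Iwasawa invariants `μ(θ)`, `λ(θ)` of PW §3.1, for `θ ∈ 𝒪[G_n]` written in `T` (e.g.
  `(mazurTateElementK g Ω p n).map ι ∈ ℚ̄_p[T]`), are in the companion file
  `Literature/NumberTheory/IwasawaTheory/LayerIwasawaInvariants.lean` (`layerMu`, `layerLambda`).

## Orientation and sign

PW's `ξ_f({r} - {s}) = 2πi ∫_s^r f(z) dz`, so `φ⁺_f({∞} - {a/pⁿ}) = -plusSymbol f (a/pⁿ) / Ω⁺`
(the tree's `modularSymbol f r = 2πi ∫_{i∞}^r f`); the sign is immaterial for `IsPlusPeriod`,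
`IsCohomologicalPlusPeriod`, `μ`, `λ` and is absorbed by the period, and `mazurTateElementK`
follows the TREE's orientation (`mazurTateElement`, Pollack 2003 Def. 6.15) so that the rational
case is literally `mazurTateElement` (`mazurTateElementK_plusPeriod_eq`).

## Deliberately NOT here

Shimura's existence theorem (Shimura 1977, Thm. 1) and the existence of cohomological periods
(PW "clearly always exist": Shimura + finite generation of the values by Manin's trick), the minus
part `φ⁻`/`Ω⁻` and the branches `ω^i`, `i ≠ 0` (`θ_{n,i}`), PW Prop. 2.3 (interpolation
`χ(θ_n) = τ(χ) L(f, χ̄, 1)/Ω^ε`; for the tree's element this is `eval₂_mazurTateElement_eq_ratTwistedSymbolSum`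
in the rational case), Prop. 2.5 (three-term relation), Lemmas 3.1–3.3 and Thm. 4.1 (Kurihara /
Perrin-Riou stabilisation `μ(θ_{2n}) = μ^+`, `λ(θ_n) = q_n + λ^±`, printed for odd `p`), Vatsal's
canonical periods (Vatsal 1999) and their comparison with cohomological periods, and Pollack's
`L_p^±` over `𝒪_λ⟦T⟧` (Pollack 2003, Thm. 5.1) — statements for separate files.

## References

* R. Pollack, T. Weston, Duke Math. J. 156 (2011): §2.1 (2.1), §2.2, Def. 2.1, Rem. 2.2, §3.1.
  [PollackWeston2011MT]
* G. Shimura, *On the periods of modular forms*, Math. Ann. 229 (1977) 211–221, Thm. 1. [Shimura1977]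
* R. Pollack, Duke Math. J. 118 (2003), Def. 6.15 (the element `θ_n`). [Pollack2003]
* B. Mazur, J. Tate, Duke Math. J. 54 (1987) (modular elements). [MazurTate1987]
-/

noncomputable section

open scoped MatrixGroups ModularForm

open CongruenceSubgroup Polynomial Literature.NumberTheory.EllipticCurves.ModularForms

namespace Literature.NumberTheory.EllipticCurves

/-! ### Shimura periods and the `K_g`-valued plus symbol -/

section Shimura

variable {N : ℕ} (g : CuspForm (Gamma0 N) 2)

/-- **`Ω` is a (plus) Shimura period of `g`**: `Ω ≠ 0` and `plusSymbol g r / Ω ∈ K_g = coeffField g`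
for every rational cusp `r` — the weight-`2`, plus-part reading of "By a theorem of Shimura, there
exists complex numbers `Ω^±_f` such that `ξ^±_f` takes values in `V_{k-2}(K_f) Ω^±_f` where `K_f` is
the field of Fourier coefficients of `f`" (Pollack–Weston 2011, §2.2; Shimura 1977, Thm. 1). A
PREDICATE on the pair `(g, Ω)` with explicit binders; the existence of such an `Ω` for a newform is
Shimura's theorem and is NOT asserted here (for a rational newform `Ω = Ω⁺_f` works:
`isPlusPeriod_plusPeriod`). [cite: PollackWeston2011MT, §2.2 (Shimura's theorem, `φ^±_f = ξ^±_f/Ω^±_f`)] -/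
def IsPlusPeriod (Ω : ℂ) : Prop :=
  Ω ≠ 0 ∧ ∀ r : ℚ, plusSymbol g r / Ω ∈ coeffField g

/-- Unfolding lemma for `IsPlusPeriod`. [cite: PollackWeston2011MT, §2.2] -/
theorem isPlusPeriod_iff (Ω : ℂ) :
    IsPlusPeriod g Ω ↔ Ω ≠ 0 ∧ ∀ r : ℚ, plusSymbol g r / Ω ∈ coeffField g :=
  Iff.rfl

/-- A Shimura period is non-zero. [cite: PollackWeston2011MT, §2.2] -/
theorem IsPlusPeriod.ne_zero {Ω : ℂ} (h : IsPlusPeriod g Ω) : Ω ≠ 0 :=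
  h.1

/-- A Shimura period stays one after scaling by a non-zero element of `K_g` ("well-defined up to
scaling by elements `α ∈ K_f`", PW Def. 2.1). [cite: PollackWeston2011MT, §2.2 and Def. 2.1] -/
theorem IsPlusPeriod.mul {Ω : ℂ} (h : IsPlusPeriod g Ω) {α : ℂ} (hα : α ∈ coeffField g)
    (hα0 : α ≠ 0) : IsPlusPeriod g (α * Ω) := by
  refine ⟨mul_ne_zero hα0 h.1, fun r ↦ ?_⟩
  have hmem := (coeffField g).mul_mem (h.2 r) ((coeffField g).inv_mem hα)
  have : plusSymbol g r / (α * Ω) = plusSymbol g r / Ω * α⁻¹ := by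
    field_simp
  rw [this]
  exact hmem

open Classical in
/-- **The `K_g`-valued plus symbol** `[r]⁺_{g,Ω} = plusSymbol g r / Ω` as an element of the Hecke field
`K_g = coeffField g` — Pollack–Weston's `φ⁺_f := ξ⁺_f/Ω⁺_f` evaluated on `{∞} - {r}` (§2.2), in the
tree's orientation of `plusSymbol` (`= ({∞,r} + {∞,-r})/2`, `2πi∫_{i∞}^r`; PW's value is the
negative, see the module docstring). Junk value `0` when `plusSymbol g r / Ω ∉ K_g` (never the case
for a Shimura period, `IsPlusPeriod.coe_plusSymbolK`). For a rational newform and `Ω = Ω⁺_f` this is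
`ratPlusSymbol f r` (`plusSymbolK_plusPeriod_eq_algebraMap`).
[cite: PollackWeston2011MT, §2.2 (`φ^±_f := ξ^±_f/Ω^±_f`)] -/
def plusSymbolK (Ω : ℂ) (r : ℚ) : coeffField g :=
  if h : plusSymbol g r / Ω ∈ coeffField g then ⟨plusSymbol g r / Ω, h⟩ else 0

/-- When `plusSymbol g r / Ω ∈ K_g`, `plusSymbolK g Ω r` is that complex number.
[cite: PollackWeston2011MT, §2.2] -/
theorem coe_plusSymbolK_of_mem {Ω : ℂ} {r : ℚ} (h : plusSymbol g r / Ω ∈ coeffField g) :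
    ((plusSymbolK g Ω r : coeffField g) : ℂ) = plusSymbol g r / Ω := by
  classical
  rw [plusSymbolK, dif_pos h]

/-- For a Shimura period, `(plusSymbolK g Ω r : ℂ) = plusSymbol g r / Ω` for every `r`.
[cite: PollackWeston2011MT, §2.2] -/
theorem IsPlusPeriod.coe_plusSymbolK {Ω : ℂ} (hΩ : IsPlusPeriod g Ω) (r : ℚ) :
    ((plusSymbolK g Ω r : coeffField g) : ℂ) = plusSymbol g r / Ω :=
  coe_plusSymbolK_of_mem g (hΩ.2 r)

/-- For a Shimura period, `[r]⁺_{g,Ω} · Ω = plusSymbol g r`. [cite: PollackWeston2011MT, §2.2] -/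
theorem IsPlusPeriod.coe_plusSymbolK_mul {Ω : ℂ} (hΩ : IsPlusPeriod g Ω) (r : ℚ) :
    ((plusSymbolK g Ω r : coeffField g) : ℂ) * Ω = plusSymbol g r := by
  rw [hΩ.coe_plusSymbolK, div_mul_cancel₀ _ hΩ.1]

variable {g}

/-- **Rational newforms: `Ω⁺_f` is a Shimura period.** For a normalised newform `f` with rational
coefficients, `plusSymbol f r / Ω⁺_f = [r]⁺_f ∈ ℚ ⊆ K_f` (Manin–Drinfeld, tree theorem
`ratCast_ratPlusSymbol_mul_plusPeriod`) and `Ω⁺_f > 0` (`IsNewform0.plusPeriod_pos_holds`).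
[cite: MazurTateTeitelbaum1986Invent, §I.8] -/
theorem isPlusPeriod_plusPeriod [NeZero N] {f : CuspForm (Gamma0 N) 2} (hf : IsNewform0 f)
    (hQ : coeffField f = ⊥) : IsPlusPeriod f (plusPeriod f : ℂ) := by
  have hΩ : (plusPeriod f : ℂ) ≠ 0 := by
    exact_mod_cast (IsNewform0.plusPeriod_pos_holds hf hQ).ne'
  refine ⟨hΩ, fun r ↦ ?_⟩
  rw [← ratCast_ratPlusSymbol_mul_plusPeriod f hf hQ r, mul_div_cancel_right₀ _ hΩ]
  exact SubfieldClass.ratCast_mem (coeffField f) (ratPlusSymbol f r)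

/-- **Rational newforms: `[r]⁺_{f,Ω⁺_f} = ratPlusSymbol f r`** as complex numbers.
[cite: MazurTateTeitelbaum1986Invent, §I.8] -/
theorem coe_plusSymbolK_plusPeriod [NeZero N] {f : CuspForm (Gamma0 N) 2} (hf : IsNewform0 f)
    (hQ : coeffField f = ⊥) (r : ℚ) :
    ((plusSymbolK f (plusPeriod f : ℂ) r : coeffField f) : ℂ) = ((ratPlusSymbol f r : ℚ) : ℂ) := by
  have hΩ : (plusPeriod f : ℂ) ≠ 0 := by
    exact_mod_cast (IsNewform0.plusPeriod_pos_holds hf hQ).ne'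
  rw [(isPlusPeriod_plusPeriod hf hQ).coe_plusSymbolK, ← ratCast_ratPlusSymbol_mul_plusPeriod f hf hQ r,
    mul_div_cancel_right₀ _ hΩ]

/-- **Rational newforms: `[r]⁺_{f,Ω⁺_f} = ratPlusSymbol f r` in `K_f`** (through `ℚ → K_f`).
[cite: MazurTateTeitelbaum1986Invent, §I.8] -/
theorem plusSymbolK_plusPeriod_eq_algebraMap [NeZero N] {f : CuspForm (Gamma0 N) 2}
    (hf : IsNewform0 f) (hQ : coeffField f = ⊥) (r : ℚ) :
    plusSymbolK f (plusPeriod f : ℂ) r = algebraMap ℚ (coeffField f) (ratPlusSymbol f r) := by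
  apply Subtype.ext
  rw [coe_plusSymbolK_plusPeriod hf hQ r]
  simp

end Shimura

/-! ### Mazur–Tate elements with coefficients in `K_g` -/

section MazurTate

variable {N : ℕ} (g : CuspForm (Gamma0 N) 2) (Ω : ℂ) (p : ℕ) [Fact p.Prime]

/-- **The Mazur–Tate element `θ_n(g) ∈ K_g[T]` of a weight-`2` newform with Hecke field `K_g`,
relative to the period `Ω`** — Pollack–Weston 2011, (2.1): `ϑ_n(φ) = ∑_{a ∈ (ℤ/pⁿ)^×} φ({∞} - {a/pⁿ}) σ_a
∈ R[𝒢_n]`, projected to `R[G_n]` along `𝒢_{n+1} ≅ G_n × (ℤ/p)^×` by the trivial branch `ω⁰`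
("We simply write `θ_n(φ)` for `θ_{n,0}(φ)`", §2.1), for `φ = φ⁺_g = ξ⁺_g/Ω` (§2.2) — written
EXACTLY as the tree's `mazurTateElement` (Pollack 2003, Def. 6.15; same Teichmüller parametrisation
`a = η γ^s` of `(ℤ/p^{n+e₀})^×`, `γ = cyclotomicGenerator p`, `1 + T ↔ γ`, canonical lift of degree
`< pⁿ`; for `p = 2` the level is `2^{n+2}`, `Γ = 1 + 4ℤ₂`) with the rational plus symbol
`ratPlusSymbol f` replaced by the `K_g`-valued `plusSymbolK g Ω`. For a rational newform and
`Ω = Ω⁺_f` it IS `mazurTateElement f p n` (`mazurTateElementK_plusPeriod_eq`). Read in `ℚ̄_p[T]`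
through `ι : K_g → ℚ̄_p` as `(mazurTateElementK g Ω p n).map ι` (PW: "via our fixed embedding
`ℚ̄ ↪ ℚ̄_p`"). [cite: PollackWeston2011MT, §2.1 (2.1) and §2.2] -/
def mazurTateElementK (n : ℕ) : (coeffField g)[X] :=
  ∑ᶠ ξ : rootsOfUnity (torsionOrder p) ℤ_[p], ∑ s : ZMod (p ^ n),
    C (plusSymbolK g Ω
        (((PadicInt.toZModPow (n + cyclotomicExponent p) ((ξ : ℤ_[p]ˣ) : ℤ_[p]) *
              (cyclotomicGenerator p : ZMod (p ^ (n + cyclotomicExponent p))) ^ s.val).val : ℚ) /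
          (p : ℚ) ^ (n + cyclotomicExponent p))) *
      (X + 1) ^ s.val

variable {g Ω p}

/-- **Rational newforms: `θ_n(f) ∈ K_f[T]` relative to `Ω⁺_f` is the tree's `mazurTateElement f p n`**
(mapped along `ℚ → K_f`), coefficient by coefficient (`plusSymbolK_plusPeriod_eq_algebraMap`).
[cite: Pollack2003, Def. 6.15] -/
theorem mazurTateElementK_plusPeriod_eq [NeZero N] {f : CuspForm (Gamma0 N) 2} (hf : IsNewform0 f)
    (hQ : coeffField f = ⊥) (n : ℕ) :
    mazurTateElementK f (plusPeriod f : ℂ) p n =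
      (mazurTateElement f p n).map (algebraMap ℚ (coeffField f)) := by
  classical
  haveI := neZero_torsionOrder p
  haveI := Fintype.ofFinite (rootsOfUnity (torsionOrder p) ℤ_[p])
  simp only [mazurTateElementK, mazurTateElement, finsum_eq_sum_of_fintype, Polynomial.map_sum,
    Polynomial.map_mul, Polynomial.map_pow, Polynomial.map_add, Polynomial.map_X, Polynomial.map_one,
    Polynomial.map_C, plusSymbolK_plusPeriod_eq_algebraMap hf hQ]

/-- The coefficients of `θ_n`: `coeff_j θ_n = ∑_η ∑_s [η γ^s/p^{n+e₀}]⁺ · (s choose j)` (binomial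
expansion of `(1 + T)^s`). [cite: PollackWeston2011MT, §2.1 (2.1)] -/
theorem coeff_mazurTateElementK [Fintype (rootsOfUnity (torsionOrder p) ℤ_[p])] (n j : ℕ) :
    (mazurTateElementK g Ω p n).coeff j =
      ∑ ξ : rootsOfUnity (torsionOrder p) ℤ_[p], ∑ s : ZMod (p ^ n),
        plusSymbolK g Ω
            (((PadicInt.toZModPow (n + cyclotomicExponent p) ((ξ : ℤ_[p]ˣ) : ℤ_[p]) *
                  (cyclotomicGenerator p : ZMod (p ^ (n + cyclotomicExponent p))) ^ s.val).val : ℚ) /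
              (p : ℚ) ^ (n + cyclotomicExponent p)) *
          (s.val.choose j : coeffField g) := by
  classical
  rw [mazurTateElementK, finsum_eq_sum_of_fintype, finsetSum_coeff]
  refine Finset.sum_congr rfl fun ξ _ ↦ ?_
  rw [finsetSum_coeff]
  refine Finset.sum_congr rfl fun s _ ↦ ?_
  rw [coeff_C_mul, coeff_X_add_one_pow]

end MazurTate

/-! ### Cohomological periods with respect to a `p`-adic embedding (Pollack–Weston Def. 2.1) -/

section Cohomological

variable {N : ℕ} (g : CuspForm (Gamma0 N) 2) {p : ℕ} [Fact p.Prime]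
  (ι : coeffField g →+* PadicAlgCl p)

/-- **`Ω` is a COHOMOLOGICAL (plus) period of `g` with respect to the embedding `ι : K_g → ℚ̄_p`**
(Pollack–Weston 2011, **Definition 2.1**, weight `2`, plus part): `Ω` is a Shimura period
(`IsPlusPeriod g Ω`), every value `[r]⁺_{g,Ω}` is `p`-integral along `ι` (`‖ι [r]⁺‖ ≤ 1`, i.e.
`ι [r]⁺ ∈ 𝒪_g`, the integers of the completion of `ι(K_g)`), and at least one value is a unit
(`‖ι [r]⁺‖ = 1`). PW: "We say that `Ω⁺_f` and `Ω⁻_f` are cohomological periods for `f` (with respect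
to our fixed embedding `ℚ̄ ↪ ℚ̄_p`), if `‖φ⁺_f‖ = ‖φ⁻_f‖ = 1`; that is, if each of `φ⁺_f` and `φ⁻_f`
takes values in `V_{k-2}(𝒪_f)`, and each takes on at least one value with at least one coefficient in
`𝒪_f^×`. Such periods clearly always exist for each `f` and are well-defined up to scaling by elements
`α ∈ K_f` such that the image of `α` in `ℚ̄_p` is a `p`-adic unit." (`‖φ‖ = max_{D ∈ Δ₀} ‖φ(D)‖`; in
weight `2` the values on `Δ₀` are differences of the values on the `{∞} - {r}`, so by the ultrametric
inequality the two clauses here say exactly `‖φ⁺_g‖ = 1`.) A PREDICATE; existence NOT asserted.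
[cite: PollackWeston2011MT, Def. 2.1] -/
def IsCohomologicalPlusPeriod (Ω : ℂ) : Prop :=
  IsPlusPeriod g Ω ∧ (∀ r : ℚ, ‖ι (plusSymbolK g Ω r)‖ ≤ 1) ∧ ∃ r : ℚ, ‖ι (plusSymbolK g Ω r)‖ = 1

/-- Unfolding lemma for `IsCohomologicalPlusPeriod`. [cite: PollackWeston2011MT, Def. 2.1] -/
theorem isCohomologicalPlusPeriod_iff (Ω : ℂ) :
    IsCohomologicalPlusPeriod g ι Ω ↔
      IsPlusPeriod g Ω ∧ (∀ r : ℚ, ‖ι (plusSymbolK g Ω r)‖ ≤ 1) ∧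
        ∃ r : ℚ, ‖ι (plusSymbolK g Ω r)‖ = 1 :=
  Iff.rfl

variable {g ι}

/-- A cohomological period is a Shimura period. [cite: PollackWeston2011MT, Def. 2.1] -/
theorem IsCohomologicalPlusPeriod.isPlusPeriod {Ω : ℂ} (h : IsCohomologicalPlusPeriod g ι Ω) :
    IsPlusPeriod g Ω :=
  h.1

/-- For a cohomological period every `[r]⁺` is `ι`-integral. [cite: PollackWeston2011MT, Def. 2.1] -/
theorem IsCohomologicalPlusPeriod.norm_le_one {Ω : ℂ} (h : IsCohomologicalPlusPeriod g ι Ω) (r : ℚ) :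
    ‖ι (plusSymbolK g Ω r)‖ ≤ 1 :=
  h.2.1 r

/-- For a cohomological period every `ι [r]⁺` lies in `𝒪 = padicCoeffIntegers (range ι)`, the ring of
integers of `ℚ_p(ι K_g) ⊆ ℚ̄_p` (PW's `𝒪_f`). [cite: PollackWeston2011MT, Def. 2.1] -/
theorem IsCohomologicalPlusPeriod.mem_padicCoeffIntegers {Ω : ℂ} (h : IsCohomologicalPlusPeriod g ι Ω)
    (r : ℚ) : ι (plusSymbolK g Ω r) ∈ padicCoeffIntegers (Set.range ι) :=
  ⟨IntermediateField.subset_adjoin ℚ_[p] _ ⟨_, rfl⟩, h.norm_le_one r⟩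

/-- The norm of a natural number in `ℚ̄_p` is at most `1` (private helper). [folklore] -/
private theorem norm_natCast_padicAlgCl_le_one (m : ℕ) : ‖(m : PadicAlgCl p)‖ ≤ 1 := by
  rw [← map_natCast (algebraMap ℚ_[p] (PadicAlgCl p)) m]
  change ‖((m : ℚ_[p]) : PadicAlgCl p)‖ ≤ 1
  rw [PadicAlgCl.norm_extends]
  simpa using Padic.norm_int_le_one (p := p) (m : ℤ)

/-- **Cohomological periods make the Mazur–Tate elements integral** (Pollack–Weston 2011,
**Remark 2.2**: "We note that our choice of periods forces these Mazur–Tate elements to have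
integral coefficients", `θ_n(f) ∈ 𝒪_f[G_n]`): every coefficient of `(θ_n(g)).map ι ∈ ℚ̄_p[T]` has
norm `≤ 1` — each is `∑_η ∑_s ι[η γ^s/p^{n+e₀}]⁺ · (s choose j)` (`coeff_mazurTateElementK`), a sum
of products of elements of norm `≤ 1` in the ultrametric field `ℚ̄_p`. [cite: PollackWeston2011MT, Rem. 2.2] -/
theorem IsCohomologicalPlusPeriod.norm_coeff_map_mazurTateElementK_le_one {Ω : ℂ}
    (h : IsCohomologicalPlusPeriod g ι Ω) (n j : ℕ) :
    ‖((mazurTateElementK g Ω p n).map ι).coeff j‖ ≤ 1 := by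
  classical
  haveI := neZero_torsionOrder p
  haveI := Fintype.ofFinite (rootsOfUnity (torsionOrder p) ℤ_[p])
  rw [coeff_map, coeff_mazurTateElementK, map_sum]
  refine IsUltrametricDist.norm_sum_le_of_forall_le_of_nonneg zero_le_one fun ξ _ ↦ ?_
  rw [map_sum]
  refine IsUltrametricDist.norm_sum_le_of_forall_le_of_nonneg zero_le_one fun s _ ↦ ?_
  rw [map_mul, map_natCast, norm_mul]
  exact mul_le_one₀ (h.norm_le_one _) (norm_nonneg _) (norm_natCast_padicAlgCl_le_one _)

/-- Hence, for a cohomological period, the supremum norm of `(θ_n(g)).map ι` is at most `1`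
(`μ(θ_n(g)) ≥ 0`, `Literature.NumberTheory.IwasawaTheory.layerMu_nonneg_iff`). [cite: PollackWeston2011MT, Rem. 2.2] -/
theorem IsCohomologicalPlusPeriod.supNorm_map_mazurTateElementK_le_one {Ω : ℂ}
    (h : IsCohomologicalPlusPeriod g ι Ω) (n : ℕ) :
    ((mazurTateElementK g Ω p n).map ι).supNorm ≤ 1 := by
  obtain ⟨j, hj⟩ := ((mazurTateElementK g Ω p n).map ι).exists_eq_supNorm
  rw [hj]
  exact h.norm_coeff_map_mazurTateElementK_le_one n j

end Cohomological

/-! ### Change of period (Pollack–Weston Def. 2.1: the symbols are "well-defined up to scaling by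
elements `α ∈ K_f`") -/

section ChangeOfPeriod

variable {N : ℕ} {g : CuspForm (Gamma0 N) 2}

/-- **Two Shimura periods rescale the `K_g`-valued plus symbol by a non-zero element of `K_g`.** If
`Ω` and `Ω'` are plus periods of `g` (`IsPlusPeriod`), there is `α ∈ K_g`, `α ≠ 0`, with
`[r]⁺_{g,Ω} = α · [r]⁺_{g,Ω'}` for every rational `r`: when some plus symbol `plusSymbol g r₀` is
non-zero, `α = [r₀]⁺_{g,Ω} / [r₀]⁺_{g,Ω'}` (`= Ω'/Ω` as a complex number); when all plus symbols
vanish both sides are `0` and `α = 1` works. This is Pollack–Weston's remark that the periods (hence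
the symbols `φ⁺_f = ξ⁺_f/Ω⁺_f`) are "well-defined up to scaling by elements `α ∈ K_f`" (Def. 2.1),
proved from the definitions. [cite: PollackWeston2011MT, §2.2 and Def. 2.1] -/
theorem IsPlusPeriod.exists_plusSymbolK_eq_mul {Ω Ω' : ℂ} (hΩ : IsPlusPeriod g Ω)
    (hΩ' : IsPlusPeriod g Ω') :
    ∃ α : coeffField g, α ≠ 0 ∧ ∀ r : ℚ, plusSymbolK g Ω r = α * plusSymbolK g Ω' r := by
  classical
  by_cases h : ∃ r₀ : ℚ, plusSymbol g r₀ ≠ 0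
  · obtain ⟨r₀, hr₀⟩ := h
    -- the values at `r₀` are non-zero for both periods
    have hne : ∀ (Ω₁ : ℂ), IsPlusPeriod g Ω₁ → plusSymbolK g Ω₁ r₀ ≠ 0 := by
      intro Ω₁ hΩ₁ h0
      have h1 : ((plusSymbolK g Ω₁ r₀ : coeffField g) : ℂ) = 0 := by
        rw [h0]
        rfl
      rw [IsPlusPeriod.coe_plusSymbolK g hΩ₁, div_eq_zero_iff] at h1
      rcases h1 with h1 | h1
      · exact hr₀ h1
      · exact hΩ₁.1 h1
    refine ⟨plusSymbolK g Ω r₀ / plusSymbolK g Ω' r₀, div_ne_zero (hne Ω hΩ) (hne Ω' hΩ'),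
      fun r ↦ ?_⟩
    apply Subtype.ext
    rw [IntermediateField.coe_mul, IntermediateField.coe_div,
      IsPlusPeriod.coe_plusSymbolK g hΩ, IsPlusPeriod.coe_plusSymbolK g hΩ,
      IsPlusPeriod.coe_plusSymbolK g hΩ', IsPlusPeriod.coe_plusSymbolK g hΩ']
    have hΩ0 : Ω ≠ 0 := hΩ.1
    have hΩ'0 : Ω' ≠ 0 := hΩ'.1
    field_simp
  · push Not at h
    refine ⟨1, one_ne_zero, fun r ↦ ?_⟩
    have hz : ∀ (Ω₁ : ℂ), IsPlusPeriod g Ω₁ → plusSymbolK g Ω₁ r = 0 := by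
      intro Ω₁ hΩ₁
      apply Subtype.ext
      rw [IsPlusPeriod.coe_plusSymbolK g hΩ₁, h r, zero_div]
      rfl
    rw [hz Ω hΩ, hz Ω' hΩ', mul_zero]

/-- **Two Shimura periods rescale the Mazur–Tate elements by a non-zero element of `K_g`**: if `Ω`,
`Ω'` are plus periods of `g` there is `α ∈ K_g`, `α ≠ 0`, with `θ_n(g; Ω) = C α · θ_n(g; Ω')` in
`K_g[T]` for every prime `p` and every layer `n` (coefficient by coefficient from
`IsPlusPeriod.exists_plusSymbolK_eq_mul`; PW Def. 2.1 "well-defined up to scaling"). In particular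
the layer invariants `μ`, `λ` of `(θ_n(g; Ω)).map ι` do not depend on the choice of the plus period
up to the valuation of `ι α`. [cite: PollackWeston2011MT, §2.1 (2.1), §2.2 and Def. 2.1] -/
theorem IsPlusPeriod.exists_mazurTateElementK_eq_C_mul {Ω Ω' : ℂ} (hΩ : IsPlusPeriod g Ω)
    (hΩ' : IsPlusPeriod g Ω') :
    ∃ α : coeffField g, α ≠ 0 ∧ ∀ (p : ℕ) [Fact p.Prime] (n : ℕ),
      mazurTateElementK g Ω p n = C α * mazurTateElementK g Ω' p n := by
  obtain ⟨α, hα, h⟩ := hΩ.exists_plusSymbolK_eq_mul hΩ'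
  refine ⟨α, hα, fun p _ n ↦ ?_⟩
  classical
  haveI := neZero_torsionOrder p
  haveI := Fintype.ofFinite (rootsOfUnity (torsionOrder p) ℤ_[p])
  simp only [mazurTateElementK, finsum_eq_sum_of_fintype, Finset.mul_sum, h, map_mul, mul_assoc]

end ChangeOfPeriod



end Literature.NumberTheory.EllipticCurves

end
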